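import Summits.BirchSwinnertonDyer.BirchSwinnertonDyer.Theorems.EdixhovenFibreFiveSevenStarredOptimalManinUnitFiveSeven
import Summits.BirchSwinnertonDyer.BirchSwinnertonDyer.Theorems.EdixhovenFibreFiveSevenTwistDegreeStepFiveSevenOfKatoTransfer
import Summits.BirchSwinnertonDyer.BirchSwinnertonDyer.Theorems.EdixhovenFibreFiveSevenTwistDegreeStepOrdinary
import Summits.BirchSwinnertonDyer.BirchSwinnertonDyer.Theorems.TeichmullerTwistDescentCellsOfKatoTransfer
import HarnessLib

/-!
# Route `EdixhovenFibreFiveSeven` (EF57): the WHOLE Manin side — K★ (22226), TDS57 (22227), TDS11 (22228), KP57 (23810),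
# CORNER (23883), LOW (23884) — and the rung W-ALL/2.p>=5.r1 through the route's OWN deciding theorem `closes`,
# GRANTED ONLY the route's REGISTERED hypothesis bundles (`--supports stmt-BirchSwinnertonDyer-22226`)

Cell `pub/bsd-wall` (D-0145 line route-BirchSwinnertonDyer-EdixhovenFibreFiveSeven, OPEN rev 3), seat `bsd-line-edix-p1`
(prover seat 1/3, g9; crux of record K★ `StarredOptimalManinUnitFiveSeven`, stmt-BirchSwinnertonDyer-22226). THEOREMS ONLY
(no definition, no named fact, no `sorry`); every theorem is `proof.conditional` on hypothesis-only bundles that display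
cite-only PRINTED facts; nothing is closed by name; BSD is not proved by this file.

WHAT THIS FILE RECORDS (the EF57 twin of seat bsd-line-ttd-p2's `TeichmullerTwistDescentCellsOfKato.lean`, p596449, §3–§4).
After the F″ lane of the cell (seats edix-p1 … p5, manin-p1, ttd-p1/p2) every Manin-side declaration of the EF57 route file
is a tree theorem GRANTED Kato's fact F″ = `kato_neron_isIntegral_twistedSymbolSum_of_additive_five_le` [and modularity
`exists_isNewformOf`], both cite-only and both DISPLAYED inside the route's registered bundles
`KatoNeronAndCremonaFacts` (stmt-BirchSwinnertonDyer-23789: F″ ∧ Cremona) and `PublishedInputsAdditiveKoly`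
(stmt-BirchSwinnertonDyer-20137: … ∧ `exists_isNewformOf` ∧ …):

* the four EF57-ONLY Manin decls BY NAME from the two bundles: `starredOptimalManinUnitFiveSeven_of_pubBundles` (K★,
  via p581141 `starredOptimalManinUnitFiveSeven_of_kato`), `twistDegreeStepFiveSeven_of_pubBundles` (TDS57, via
  `LTwistTransfer.twistDegreeStepFiveSeven_of_kato` — Road A′ with the Chebotarev witness PROVED, p596221/p595883; NO
  Kosters–Pannekoek residue hypothesis and NO Cremona, unlike the closed twin 23812),
  `twistDegreeStepOrdinary_of_pubBundles` (TDS11, via `twistDegreeStepOrdinary_of_kato_five_le`),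
  `kpResidueManinUnitFiveSeven_of_pubBundles` (KP57, via `LTwistTransfer.kpResidueManinUnitFiveSeven_of_kato`); and
  `maninSide_of_pubBundles` — all SIX Manin decls of the route at once, the shared CORNER (23883) / LOW (23884) components being
  Manin's `p`-part at every lattice-optimal datum (`TeichmullerTwistDescent.not_dvd_c_of_kato_of_transferWitness`, edix-p2 g3,
  at manin-p1's PROVED witness `AuxPrime.transferWitness`), exactly as in ttd-p2's by-name theorems for the TTD copies
  (`TeichmullerTwistDescent.…_of_pubBundles`, p596449 — definitionally the same statements, not restated here).
* NOT restated here (gate dedup: definitionally identical, already landed): the rung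
  `Summit.BirchSwinnertonDyer.WAllExclAdditiveFiveLeRankOne` from EF57's REGISTERED items only — the three AKR-shared open
  cruxes `KolyvaginPrimitiveAdditive` (21400), `RankZeroAdditive` (20133), `OffSharpRankOneAdditive` (20134) and the three
  bundles (20137, 22230, 23789) — IS the tree theorem
  `Summit.BirchSwinnertonDyer.BirchSwinnertonDyer.Theorems.TeichmullerTwistDescent.wAllExclAdditiveFiveLeRankOne_of_closes_of_pubBundles`
  (p596449): its six hypotheses are the TTD route's copies of the SAME six shared items, definitionally equal to EF57's.
  That term is what a re-key of `Theses.EdixhovenFibreFiveSeven.closes` onto {21400, 20133, 20134} ∪ {20137, 22230, 23789}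
  would cite (planner's call); this seat checked (farm, rc 0) that the EF57-namespaced statement elaborates with
  `closes (kpResidueManinUnitFiveSeven_of_pubBundles hKC hP) starredOptimalManinUnitFiveSevenOfKato_proof
  twistDegreeStepFiveSevenOfKP_proof (twistDegreeStepOrdinary_of_pubBundles hKC) memberManinUnitFiveSevenGlue_proof
  h₁ h₀ hoff hP hF hKC` — i.e. `closes` with ALL ELEVEN hypotheses fed from those six items and the closed twins/glue.

HONEST STATUS (numbers): open NON-bundle antecedents of the rung on this route = 3 (AKR Kolyvagin side, open in print);
Manin-side route decls that are binders of `closes` and NOT yet inside a bundle-keyed item = 2 (KP57 = hK, TDS11 = hO);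
cite-only printed facts behind the EF57 Manin side = 2 (F″ inside 23789; modularity inside 20137); Cremona's table (the
second conjunct of 23789) is NOT used by any theorem here. The six Manin items stay OPEN by name (their statements are
unconditional; F″ has no `_holds` — after the cell's assembly F″ ⟸ {Kato P1 `Kato2004.exists_member_sl2ZetaElement_neron_values`,
(S5b-tower), Kato II Prop. 1.2.3, de Rham for `V_pE`}, all cite-only). `proof.conditional` by design; no item is closed by
this; BSD is not proved by this; no W-ALL class theorem is proved by this.
[cite: Kato2004Asterisque, (8.1.3) (p. 180), Thm. 9.7 (p. 189), Thm. 6.6 (1) (p. 163)] [cite: KimNakamura2020, Cor. 2.4]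
[cite: KostersPannekoek2017, Thm. 1 and Cor. 2] [cite: TateGCFT1967, §2.4 (Tchebotarev density theorem)]
[cite: BCDTJAMS2001, Thm. A] [cite: WZhang2014, Thm. 1.1]
-/

set_option autoImplicit false
-- single-conjunct summit: `Summit.BirchSwinnertonDyer.BirchSwinnertonDyer.…` repeats the name by design (D-0017)
set_option linter.dupNamespace false

noncomputable section

open WeierstrassCurve Literature.NumberTheory.EllipticCurves Literature.NumberTheory.EllipticCurves.ModularForms
  Literature.NumberTheory.EllipticCurves.Rank1Residual
  Summit.BirchSwinnertonDyer.BirchSwinnertonDyer.Theses.EdixhovenFibreFiveSeven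
  Summit.BirchSwinnertonDyer.BirchSwinnertonDyer.Theorems

namespace Summit.BirchSwinnertonDyer.BirchSwinnertonDyer.Theorems.EdixhovenFibreFiveSevenPubBundles

/-! ### The Manin-side declarations of the route BY NAME from the two registered bundles -/

/-- **K★ `StarredOptimalManinUnitFiveSeven` (stmt-BirchSwinnertonDyer-22226) from the bundle `KatoNeronAndCremonaFacts`
(23789) alone** — its first conjunct F″ fed to p581141 `starredOptimalManinUnitFiveSeven_of_kato` (the `p ∈ {5,7}`
tame-twist lever + the tree's no-`p`-torsion theorem on `4 < ord_p Δ_min`); the Cremona conjunct is idle. The closed twin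
23811 is this with the bundle as antecedent. CONDITIONAL (hypothesis-only bundle); the crux is not closed by this; BSD is
not proved by this. [cite: Kato2004Asterisque, (8.1.3) (p. 180), Thm. 9.7 (p. 189)] [cite: KimNakamura2020, Cor. 2.4] -/
theorem starredOptimalManinUnitFiveSeven_of_pubBundles (hKC : KatoNeronAndCremonaFacts) :
    StarredOptimalManinUnitFiveSeven :=
  starredOptimalManinUnitFiveSeven_of_kato hKC.1

/-- **TDS57 `TwistDegreeStepFiveSeven` (stmt-BirchSwinnertonDyer-22227) from `KatoNeronAndCremonaFacts` alone** — F″ fed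
to `LTwistTransfer.twistDegreeStepFiveSeven_of_kato` (the transfer road A′ with its Chebotarev witness
`AuxPrime.transferWitness` PROVED; no Ihara lemma, no Kosters–Pannekoek residue hypothesis, no Cremona). CONDITIONAL;
the crux is not closed by this; BSD is not proved by this. [cite: Kato2004Asterisque, (8.1.3) (p. 180), Thm. 9.7 (p. 189)]
[cite: KostersPannekoek2017, Thm. 1 and Cor. 2] [cite: TateGCFT1967, §2.4 (Tchebotarev density theorem)] -/
theorem twistDegreeStepFiveSeven_of_pubBundles (hKC : KatoNeronAndCremonaFacts) : TwistDegreeStepFiveSeven :=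
  LTwistTransfer.twistDegreeStepFiveSeven_of_kato hKC.1

/-- **TDS11 `TwistDegreeStepOrdinary` (stmt-BirchSwinnertonDyer-22228) from `KatoNeronAndCremonaFacts` alone** — F″
specialised to `7 < p` and fed to `EdixhovenFibreFiveSevenTwistDegreeStepOrdinary.twistDegreeStepOrdinary_of_kato_five_le`
(the AKR tame-twist lever at `p ≥ 11`). CONDITIONAL; the crux is not closed by this; BSD is not proved by this.
[cite: Kato2004Asterisque, (8.1.3) (p. 180), Thm. 9.7 (p. 189)] [cite: EdixhovenManin1991, §4 (cases 1/2)] -/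
theorem twistDegreeStepOrdinary_of_pubBundles (hKC : KatoNeronAndCremonaFacts) : TwistDegreeStepOrdinary :=
  EdixhovenFibreFiveSevenTwistDegreeStepOrdinary.twistDegreeStepOrdinary_of_kato_five_le hKC.1

/-- **KP57 `KPResidueManinUnitFiveSeven` (stmt-BirchSwinnertonDyer-23810) from the TWO registered bundles** — modularity
(the sixth conjunct of `PublishedInputsAdditiveKoly`, 20137) and F″ (first conjunct of `KatoNeronAndCremonaFacts`,
23789) fed to `LTwistTransfer.kpResidueManinUnitFiveSeven_of_kato`. A twin «KatoNeronAndCremonaFacts →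
PublishedInputsAdditiveKoly → KPResidueManinUnitFiveSeven» closes by `exact` this. CONDITIONAL; the crux is not closed
by this; BSD is not proved by this. [cite: Kato2004Asterisque, Thm. 9.7 (p. 189)] [cite: KostersPannekoek2017, Cor. 2]
[cite: BCDTJAMS2001, Thm. A] -/
theorem kpResidueManinUnitFiveSeven_of_pubBundles (hKC : KatoNeronAndCremonaFacts)
    (hP : PublishedInputsAdditiveKoly) : KPResidueManinUnitFiveSeven :=
  LTwistTransfer.kpResidueManinUnitFiveSeven_of_kato hP.2.2.2.2.2.1 hKC.1

/-- **All SIX Manin-side declarations of the EF57 route file — K★ (22226), TDS57 (22227), TDS11 (22228), KP57 (23810),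
CORNER (23883), LOW (23884) — from the two REGISTERED bundles `KatoNeronAndCremonaFacts` (23789) and
`PublishedInputsAdditiveKoly` (20137) ONLY** (K★, TDS57, TDS11 from the first alone; the shared CORNER / LOW components = Manin's `p`-part at every lattice-optimal
datum, `TeichmullerTwistDescent.not_dvd_c_of_kato_of_transferWitness` at the proved witness, their cell / Weil-type /
torsion binders idle — by name these two are ttd-p2's `TeichmullerTwistDescent.…_of_pubBundles`, definitionally). The glue items G57 (22229) and
the KP57 split glue (24320) are closed by their own `_proof`s and not repeated. CONDITIONAL (hypothesis-only bundles); nothing closed; BSD is not proved by this.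
[cite: Kato2004Asterisque, (8.1.3) (p. 180), Thm. 9.7 (p. 189)] [cite: TateGCFT1967, §2.4 (Tchebotarev density theorem)] -/
theorem maninSide_of_pubBundles (hKC : KatoNeronAndCremonaFacts) (hP : PublishedInputsAdditiveKoly) :
    StarredOptimalManinUnitFiveSeven ∧ TwistDegreeStepFiveSeven ∧ TwistDegreeStepOrdinary ∧
      KPResidueManinUnitFiveSeven ∧ KummerCornerTorsionOptimalManinUnit ∧ SupersingularTorsionOptimalManinUnitFive :=
  ⟨starredOptimalManinUnitFiveSeven_of_pubBundles hKC, twistDegreeStepFiveSeven_of_pubBundles hKC,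
    twistDegreeStepOrdinary_of_pubBundles hKC, kpResidueManinUnitFiveSeven_of_pubBundles hKC hP,
    fun W _ _ p _ _ D hcell hadd hirr _ _ hlat =>
      TeichmullerTwistDescent.not_dvd_c_of_kato_of_transferWitness hP.2.2.2.2.2.1 hKC.1 AuxPrime.transferWitness W p D
        (by rcases hcell with ⟨rfl, -⟩ | ⟨rfl, -⟩ <;> norm_num) hadd hirr hlat,
    fun W _ _ p _ _ D hcell hadd hirr _ _ hlat =>
      TeichmullerTwistDescent.not_dvd_c_of_kato_of_transferWitness hP.2.2.2.2.2.1 hKC.1 AuxPrime.transferWitness W p D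
        (by rcases hcell with ⟨rfl, -⟩ | ⟨rfl, -⟩ <;> norm_num) hadd hirr hlat⟩

end Summit.BirchSwinnertonDyer.BirchSwinnertonDyer.Theorems.EdixhovenFibreFiveSevenPubBundles

end
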